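import Literature.AlgebraicGeometry.AbelianSchemes.AbelianSchemeConstSubgroupQuotient
import Literature.AlgebraicGeometry.RelativeSpec.FiniteGroupQuotientGenericEtale
import HarnessLib

/-!
# `K`-stable affine covers from «orbits lie in affine opens» (HECKE-LINK, discharge road for the `hcov` binder of file (i))

Layer `Literature/AlgebraicGeometry/AbelianSchemes`, namespace `Literature.AlgebraicGeometry.AbelianSchemes.AbelianSchemeOver` (and a
generic lemma in `Literature.AlgebraicGeometry.RelativeSpec.ActionOver`).  Cell `hodgecm-mathlib`, HECKE-LINK line: every quotient
file of the chain ((i) p742166 … D4 p745622) carries the RAW binder `hcov : ∀ x : A.left, ∃ O : (A.translationActionOver u K).StableAffineOpens,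
x ∈ O.1` («`A` is covered by `K`-stable opens affine over `Y`»).  [MumfordAV1970] §7 Thm. p. 66 (proof: «since `X` is quasi-projective
every orbit lies in an affine open `U`; `⋂_g gU` is then a stable affine open») — ★ `ActionOver.exists_stableAffineOpen_le_of_orbit`
(p-GenericEtale) is the second half; this file packages the reduction of `hcov` to the quasi-projectivity-type input «every `K`-orbit
(a finite set of points) lies in an affine open of `A`»:
* `ActionOver.forall_exists_mem_stableAffineOpens_of_orbit` (generic: finite `G`, `X` separated, `Y` affine);
* `AbelianSchemeOver.translationActionOver_hcov_of_forall_finset` — `hcov` for the translation action of a finite `K ≤ A(S)` from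
  «every finite set of points of `A` lies in an affine open» (true for `A` (quasi-)projective over an affine base: ★
  `Morphisms.exists_form_forall_mem_basicOpen_of_finite` for `Proj`), and `…_of_isAffine` (trivial case `A` affine — never an abelian
  scheme of positive dimension, recorded only as the degenerate sanity case).
THEOREMS ONLY; no definition, no instance, no sorry.  HC_CM is proved only modulo the 7 printed citations until rung 0 closes.

## References
* [MumfordAV1970] D. Mumford, *Abelian Varieties* (1970), §7 Thm. p. 66 (proof), §7 Thm. 4 (p. 72).
-/

noncomputable section

universe u

open CategoryTheory CategoryTheory.Limits AlgebraicGeometry MonoidalCategory CartesianMonoidalCategory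
open scoped MonObj

namespace Literature.AlgebraicGeometry.RelativeSpec.ActionOver

variable {X Y : Scheme.{u}} {r : X ⟶ Y} {G : Type*} [Group G] [Finite G] (ρ : ActionOver r G)

/-- **Orbits in affine opens ⇒ a `G`-stable affine cover** (`X` separated, `Y` affine): if the orbit of every point lies in some
affine open, every point has a `G`-stable open neighbourhood affine over `Y` (★ `exists_stableAffineOpen_le_of_orbit`).
[cite: MumfordAV1970, §7 Thm. p. 66 (proof)] -/
theorem forall_exists_mem_stableAffineOpens_of_orbit [X.IsSeparated] [IsAffine Y]
    (h : ∀ x : X, ∃ U : X.Opens, IsAffineOpen U ∧ ∀ g : G, (ρ.aut g).hom x ∈ U) :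
    ∀ x : X, ∃ O : ρ.StableAffineOpens, x ∈ O.1 := by
  intro x
  obtain ⟨U, hU, hx⟩ := h x
  obtain ⟨O, hO, -⟩ := ρ.exists_stableAffineOpen_le_of_orbit x U hU hx
  exact ⟨O, hO⟩

end Literature.AlgebraicGeometry.RelativeSpec.ActionOver

namespace Literature.AlgebraicGeometry.AbelianSchemes

namespace AbelianSchemeOver

open Literature.AlgebraicGeometry.RelativeSpec

variable {S : Scheme.{u}} (A : AbelianSchemeOver S) {Y : Scheme.{u}}

/-- The total space of `A` is separated when `A → S → Y` is separated and `Y` is affine. [cite: MumfordAV1970, §7 Thm. 4 (p. 72)] -/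
theorem isSeparated_left_of_isAffine (u : S ⟶ Y) [IsAffine Y] [IsSeparated (A.X.hom ≫ u)] : A.left.IsSeparated := by
  refine ⟨?_⟩
  rw [← terminal.comp_from (A.X.hom ≫ u)]
  infer_instance

variable (u : S ⟶ Y) (K : Subgroup A.Sections) [Finite K] [IsAffine Y] [IsSeparated (A.X.hom ≫ u)]

/-- **`hcov` from «every finite set of points of `A` lies in an affine open»** (the quasi-projectivity-type input; the orbit
`{t_σ(x) : σ ∈ K}` is finite). [cite: MumfordAV1970, §7 Thm. p. 66 (proof)] -/
theorem translationActionOver_hcov_of_forall_finset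
    (h : ∀ s : Finset A.left, ∃ U : A.left.Opens, IsAffineOpen U ∧ ∀ x ∈ s, x ∈ U) :
    ∀ x : A.left, ∃ O : (A.translationActionOver u K).StableAffineOpens, x ∈ O.1 := by
  classical
  haveI := A.isSeparated_left_of_isAffine u
  haveI : Fintype K := Fintype.ofFinite K
  refine (A.translationActionOver u K).forall_exists_mem_stableAffineOpens_of_orbit fun x => ?_
  obtain ⟨U, hU, hx⟩ := h (Finset.univ.image fun σ : K => ((A.translationActionOver u K).aut σ).hom x)
  exact ⟨U, hU, fun σ => hx _ (Finset.mem_image_of_mem _ (Finset.mem_univ σ))⟩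

/-- **`hcov` when the total space of `A` is affine** (degenerate sanity case: `U = ⊤`).
[cite: MumfordAV1970, §7 Thm. p. 66 (proof)] -/
theorem translationActionOver_hcov_of_isAffine [IsAffine A.left] :
    ∀ x : A.left, ∃ O : (A.translationActionOver u K).StableAffineOpens, x ∈ O.1 :=
  A.translationActionOver_hcov_of_forall_finset u K fun _ =>
    ⟨⊤, AlgebraicGeometry.isAffineOpen_top A.left, fun _ _ => trivial⟩

end AbelianSchemeOver

end Literature.AlgebraicGeometry.AbelianSchemes

end
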